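import Literature.NumberTheory.Rogawski1990.ArchOrbFamGUnfoldedModel                 -- ★ (A5a) p851098 (F0P3b-p01 (g16)): `archRG_eq_prod_cpt_mul_prod_split`, `splitCoord_eq_add_half_add_half`, `integral_prod_eq_integral_swap_descConj`; brings ★ (A2)+(A3) `prod_normaliser_smul_integral_pi_descConj_eq_smul_integral_pi_prod_symm`, ★ `orbFamG_apply`
import Literature.NumberTheory.Rogawski1990.ArchChartOrbGIsolateFinsetSplitQuotient  -- ★ (M1-a) (this seat): `chartOrbG_eq_prod_mul_integral_pi_group_isolate_splitQuotient`; brings ★ (J-iso)^T p851292, ★ (A4) `forall_mem_pi_chartTorusGLoc_comm`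
import HarnessLib

/-!
# (M1) = (J2-a)^T — THE UNFOLDED MODEL OF `orbFamG` WITH A FINITE SET OF COMPACT PLACES ISOLATED, BINDER-FREE ON `RegG` («finset isolation in the unfolded currency»;
# Rogawski 1990 §4.9, §8.2–8.3; Folland 1995 §2.6 (2.52); Shelstad 1979 §4)

Topic `NumberTheory/Rogawski1990`; namespace `Literature.NumberTheory.Rogawski1990` (as ★ (A5a) §3).  THEOREMS ONLY (no `def`, no instance, no notation, no axiom, no named
fact, no `sorry`).  Cell `pub/hodgecm-mathlib`, crux H413 (`stmt-HodgeConjecture-24833`), F0∕P3c line LH3 (closer stub `stub_N9`, DIRECT ROAD `F0_P3c_StubN9Direct`, LEAF v6),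
organ O-L1d′ «MIXED SCALAR CORNERS» (`stub_N9hcCentralMixedJetBounds`, `hCm`): leg **(M1) «(J2-a)^T»** of F0P3a-p08 (g23)'s J2-MIXED spec (2026-09-02T12:01:38Z; dealer
LH3-plan (g4) RULING #20), seat F0P3a-p05 (g21).  Count-neutral measure-theoretic bookkeeping: nothing here closes an organ.

THE MATHEMATICS.  ★ (A5a) `orbFamG_eq_unfoldedModel_of_regG` writes the raw normalised orbital-integral chart family `orbFamG ν′ a′ S′` on the `G`-regular set as
`(compact factors) · (Π_w t_w(B′_w)) · (Π_{w∈S′} C_w) · ∫ a′(…) d((⊗_{w∈S′} κ ⊗ μ_N) ⊗ ((⊗_{w∉S′} ν′_w) ∕ ρ_cpt))` — the split places UNFOLDED to `K × N` (Shelstad's `Δ_w`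
absorbed, ★ (A2)+(A3)), the compact places as ONE quotient.  Here a FINITE SET of compact-chart places — any decidable predicate `p` with `hp : p w → w ∉ S′` (the consumer's
`p := (· ∈ T)`, `T = F ⊔ Z` the nc-singular compact places of the cube point) — is ISOLATED as a product of WHOLE GROUPS `Π_{p} U(α)_w` against `⊗_{p} ν′_w`, the remaining
compact places indexed by the FLAT subtype `ι := {w ∕∕ w ∉ S′ ∧ ¬ p w}` with an inversion-invariant Haar measure `ρ_ι` on `Π_ι T′_w` with coordinates `⊗_ι t_w` (`hρι`):
* **`orbFamG_eq_unfoldedModel_pi_isolate_of_regG`** (group form; leg (M1) of the `hCm` model):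
  `orbFamG ν′ a′ S′ c = (Π_{w∉S′} (1−e^{i(φ−θ)})(1−e^{i(ψ−θ)})(1−e^{i(ψ−φ)})) · (Π_{¬p} t_w(B′_w)) · (Π_{w∈S′} C_w) ·
     ∫_{Π_{p} U(α)_w} ( ∫_{((Π_ι U_w)⧸Π_ι T′_w) × (K×N)^{S′}} descConj γ_ι(c) (Π_ι T′) (h ↦ a′(e⁻¹((g_w γ_w(c) g_w⁻¹)_{p} ∣ φ_w⁻¹(k_w τ(0,φ_w,θ_w) τ(x_w∕2,0,0) n_w τ(x_w∕2,0,0) k_w⁻¹) ∣ h_w)))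
        d(((⊗_ι ν′_w)∕ρ_ι) ⊗ (⊗_{S′} κ⊗μ_N)) ) d(⊗_{p} ν′_w)(g)`
  — the `p`-variables OUTSIDE as ONE WHOLE-GROUP product integral (every `t_w`, `p w`, GONE: `t_w(B′_w) = t_w(T′_w)` cancels, ★ (J-iso)^T), the quotient FIRST and the split fibre
  SECOND inside (the order of ★ (A4′)∕(J2-b)∕(M3)).  ROUTE (measure identities only, no integrability beyond ★ (J-iso)^T's): `orbFamG = R′·chartOrbG` (★ `orbFamG_apply`, ★
  `archRG_eq_prod_cpt_mul_prod_split`) ∘ ★ (M1-a) `chartOrbG_eq_prod_mul_integral_pi_group_isolate_splitQuotient` ∘ ★ (A2)+(A3)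
  `prod_normaliser_smul_integral_pi_descConj_eq_smul_integral_pi_prod_symm` INSIDE the `g`-integral (spectator = the ι-quotient) ∘ ★ (A5b) `integral_prod_eq_integral_swap_descConj`.
  The one-place case `p := (· = w₀)` is ★ p851352 `orbFamG_eq_unfoldedModel_isolate_of_regG` (up to Mathlib `piUnique`).
HONEST LABEL: HC_CM is proved only modulo the 7 printed citations (2 remaining: hLiu418 = `stmt-HodgeConjecture-24832`, h413 = `stmt-HodgeConjecture-24833`) until rung 0
closes; this file moves no row of the books.

## References
* [Rogawski1990] J. D. Rogawski, *Automorphic Representations of Unitary Groups in Three Variables*, Ann. of Math. Stud. 123 (1990), §4.9 (4.9.1)–(4.9.2) p. 55, §8.2 p. 122,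
  §8.3 p. 124 (orbital integrals on the regular set, place by place; parabolic descent at the split places).
* [Folland1995] G. B. Folland, *A Course in Abstract Harmonic Analysis* (1995), §2.2, §2.6 Thm. 2.49, (2.52).
* [Shelstad1979] D. Shelstad, *Characters and inner forms of a quasi-split group over ℝ*, Compositio Math. 39 (1979), §4 pp. 22–24.
* [Gelbart1975] S. Gelbart, *Automorphic Forms on Adele Groups* (1975), §10 p. 155 (10.19).
* [BorelJacquet1979] A. Borel, H. Jacquet, *Automorphic forms and automorphic representations*, PSPM 33.1 (1979), §4.1.
* [DeitmarEchterhoff2014] A. Deitmar, S. Echterhoff, *Principles of Harmonic Analysis*, 2nd ed. (2014), Thm. 1.5.3, Cor. 1.5.4, Lemma 9.3.3.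
-/

set_option autoImplicit false

noncomputable section

open MeasureTheory MeasureTheory.Measure Set NumberField NumberField.InfinitePlace Complex Topology
open Literature.MeasureTheory.Group Literature.NumberTheory.Automorphic Literature.NumberTheory.Automorphic.UnitaryGroup Literature.NumberTheory.Automorphic.ArchCartan
open scoped ContDiff Classical ENNReal NNReal MatrixGroups

namespace Literature.NumberTheory.Rogawski1990

section IsolateFinset

variable (L : Type) [Field L] [NumberField L] [IsCMField L] (α : Fin 3 → L) (S' : Finset {w : InfinitePlace L // IsComplex w})
  [∀ w : {w : InfinitePlace L // IsComplex w}, MeasurableSpace ↥(archLocal L 3 (Matrix.diagonal α) w)]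
  [∀ w : {w : InfinitePlace L // IsComplex w}, BorelSpace ↥(archLocal L 3 (Matrix.diagonal α) w)]
  [∀ w : {w : InfinitePlace L // IsComplex w}, LocallyCompactSpace ↥(archLocal L 3 (Matrix.diagonal α) w)]
  [∀ w : {w : InfinitePlace L // IsComplex w}, SecondCountableTopology ↥(archLocal L 3 (Matrix.diagonal α) w)]
  [MeasurableSpace ↥(arch (↥(maximalRealSubfield L)) L (IsCMField.complexConj L) 3 (Matrix.diagonal α))]
  [BorelSpace ↥(arch (↥(maximalRealSubfield L)) L (IsCMField.complexConj L) 3 (Matrix.diagonal α))]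
  [∀ w : {w : InfinitePlace L // IsComplex w}, MeasurableSpace (↥(archLocal L 3 (Matrix.diagonal α) w) ⧸ chartTorusGLoc L α w S')]
  [∀ w : {w : InfinitePlace L // IsComplex w}, BorelSpace (↥(archLocal L 3 (Matrix.diagonal α) w) ⧸ chartTorusGLoc L α w S')]
  (ν'w : ∀ w : {w : InfinitePlace L // IsComplex w}, Measure ↥(archLocal L 3 (Matrix.diagonal α) w)) [∀ w, (ν'w w).IsHaarMeasure] [∀ w, (ν'w w).IsMulRightInvariant]
  (ν' : Measure ↥(arch (↥(maximalRealSubfield L)) L (IsCMField.complexConj L) 3 (Matrix.diagonal α))) [ν'.IsHaarMeasure] [ν'.IsMulRightInvariant]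
  (hν : ν' = (Measure.pi ν'w).map (archPiEquivCM 3 L (Matrix.diagonal α)).symm)
  (t : ∀ w : {w : InfinitePlace L // IsComplex w}, Measure ↥(chartTorusGLoc L α w S')) [∀ w, (t w).IsHaarMeasure] [∀ w, (t w).IsInvInvariant]
  -- the standard split group `U(J₃)(ℂ)` and the per-place transports (★ (A2)), VERBATIM ★ (A5a)
  {J : Matrix (Fin 3) (Fin 3) ℂ} (hJ : J = (StdForm.antidiagonal 3).over ℂ)
  [MeasurableSpace ↥(unitaryGroupOfForm (starRingEnd ℂ) J)] [BorelSpace ↥(unitaryGroupOfForm (starRingEnd ℂ) J)]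
  [MeasurableSpace (↥(unitaryGroupOfForm (starRingEnd ℂ) J) ⧸ torusU (starRingEnd ℂ) J)] [BorelSpace (↥(unitaryGroupOfForm (starRingEnd ℂ) J) ⧸ torusU (starRingEnd ℂ) J)]
  (φ : ∀ w : {w : {w : InfinitePlace L // IsComplex w} // w ∈ S'}, ↥(archLocal L 3 (Matrix.diagonal α) w.1) ≃ₜ* ↥(unitaryGroupOfForm (starRingEnd ℂ) J))
  (hφT : ∀ (w : {w : {w : InfinitePlace L // IsComplex w} // w ∈ S'}) (g : ↥(archLocal L 3 (Matrix.diagonal α) w.1)),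
    (φ w).toMulEquiv g ∈ torusU (starRingEnd ℂ) J ↔ g ∈ chartTorusGLoc L α w.1 S')
  (hφd : ∀ (w : {w : {w : InfinitePlace L // IsComplex w} // w ∈ S'}) (cw : Fin 3 → ℝ),
    glDiagonal 3 ℂ (fun i => Units.mk0 (boostEig cw i) (boostEig_ne_zero cw i)) = ((φ w (gprimeBlockAt L α w.1 S' cw) : ↥(unitaryGroupOfForm (starRingEnd ℂ) J)) : GL (Fin 3) ℂ))
  {K : Subgroup ↥(unitaryGroupOfForm (starRingEnd ℂ) J)} (κ : Measure ↥K) [SigmaFinite κ]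
  (μN : Measure ↥(unipotentU (starRingEnd ℂ) J)) [IsHaarMeasure μN]
  {C : {w : {w : InfinitePlace L // IsComplex w} // w ∈ S'} → ℝ≥0}
  (hμC : ∀ w : {w : {w : InfinitePlace L // IsComplex w} // w ∈ S'},
    (quotientMeasure (chartTorusGLoc L α w.1 S') (t w.1) (isClosed_chartTorusGLoc L α w.1 S') (ν'w w.1)).map
        (cosetCongr (φ w).toMulEquiv (chartTorusGLoc L α w.1 S') (torusU (starRingEnd ℂ) J) (hφT w)) =
      C w • Measure.map
        (fun p : ↥K × ↥(unipotentU (starRingEnd ℂ) J) =>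
          (QuotientGroup.mk ((p.1 : ↥(unitaryGroupOfForm (starRingEnd ℂ) J)) * (p.2 : ↥(unitaryGroupOfForm (starRingEnd ℂ) J))) :
            ↥(unitaryGroupOfForm (starRingEnd ℂ) J) ⧸ torusU (starRingEnd ℂ) J))
        (κ.prod μN))
  -- the boost torus family on `U(J₃)(ℂ)` (★ `exists_torusU_boostEig_family`), VERBATIM ★ (A5a)
  (τ : (Fin 3 → ℝ) → ↥(unitaryGroupOfForm (starRingEnd ℂ) J)) (hτT : ∀ c, τ c ∈ torusU (starRingEnd ℂ) J)
  (hτcoe : ∀ c, (((τ c : ↥(unitaryGroupOfForm (starRingEnd ℂ) J)) : GL (Fin 3) ℂ) : Matrix (Fin 3) (Fin 3) ℂ) = Matrix.diagonal (boostEig c))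
  (hτmul : ∀ c c', τ (c + c') = τ c * τ c')
  (hτd : ∀ c, ∃ d : Fin 3 → ℂˣ, glDiagonal 3 ℂ d = ((τ c : ↥(unitaryGroupOfForm (starRingEnd ℂ) J)) : GL (Fin 3) ℂ) ∧ ∀ i, (d i : ℂ) = boostEig c i)
  -- NEW: the isolated places — ANY decidable predicate on the complex places, `Fintype` instances of the two index subtypes as BINDERS (as ★ (J-iso)^T) — and the quotient of
  -- the REMAINING compact places, flat index `ι = {w ∕∕ w ∉ S′ ∧ ¬ p w}`
  (p : {w : InfinitePlace L // IsComplex w} → Prop) [DecidablePred p]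
  [Fintype {w : {w : InfinitePlace L // IsComplex w} // p w}] [Fintype {w : {w : InfinitePlace L // IsComplex w} // ¬ p w}]
  [MeasurableSpace ((∀ i : {w : {w : InfinitePlace L // IsComplex w} // w ∉ S' ∧ ¬ p w}, ↥(archLocal L 3 (Matrix.diagonal α) i.1)) ⧸
    Subgroup.pi Set.univ (fun i : {w : {w : InfinitePlace L // IsComplex w} // w ∉ S' ∧ ¬ p w} => chartTorusGLoc L α i.1 S'))]
  [BorelSpace ((∀ i : {w : {w : InfinitePlace L // IsComplex w} // w ∉ S' ∧ ¬ p w}, ↥(archLocal L 3 (Matrix.diagonal α) i.1)) ⧸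
    Subgroup.pi Set.univ (fun i : {w : {w : InfinitePlace L // IsComplex w} // w ∉ S' ∧ ¬ p w} => chartTorusGLoc L α i.1 S'))]
  (ρι : Measure ↥(Subgroup.pi Set.univ (fun i : {w : {w : InfinitePlace L // IsComplex w} // w ∉ S' ∧ ¬ p w} => chartTorusGLoc L α i.1 S')))
  [ρι.IsHaarMeasure] [ρι.IsInvInvariant]
  (hρι : Measure.map (subgroupPiCoords fun i : {w : {w : InfinitePlace L // IsComplex w} // w ∉ S' ∧ ¬ p w} => chartTorusGLoc L α i.1 S') ρι =
    Measure.pi fun i : {w : {w : InfinitePlace L // IsComplex w} // w ∉ S' ∧ ¬ p w} => t i.1)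

include hν hJ hφT hφd hμC hτT hτcoe hτmul hτd hρι in
/-- **(M1) = (J2-a)^T: THE UNFOLDED MODEL WITH A FINITE SET OF COMPACT PLACES ISOLATED (group form).**  Binders = ★ (A5a) `orbFamG_eq_unfoldedModel_of_regG`'s (frame `hα hS′`,
product reading `hν`, torus measures `t_w`, split frames `φ_w` with `hφT hφd`, ONE compact `K ≤ U(J₃)(ℂ)` with `κ`, `μ_N`, Iwasawa constants `hμC`, boost torus `τ` with
`hτT hτcoe hτmul hτd`) MINUS the `Π_{w∉S′}`-quotient data, PLUS the predicate `p` (`Fintype` binders as ★ (J-iso)^T), `hp : p w → w ∉ S′`, the ι-quotient data `ρ_ι`, `hρι`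
(`ι = {w ∕∕ w ∉ S′ ∧ ¬ p w}`), compact support `ha′s` and `G`-regularity `hc`.  THEN
`orbFamG ν′ a′ S′ c = (Π_{w∉S′} cpt_w(c)) · (Π_{¬p} t_w(B′_w)) · (Π_{w∈S′} C_w) · ∫_{Π_{p} U(α)_w} ( ∫ descConj γ_ι(c) (Π_ι T′_w) (h ↦ a′(e⁻¹(…))) d(((⊗_ι ν′_w)∕ρ_ι) ⊗ (⊗_{S′} κ⊗μ_N)) ) d(⊗_{p} ν′_w)(g)`,
the assembled element having `g_w γ_w(c) g_w⁻¹` at `p w` (Mathlib `piEquivPiSubtypeProd … p`, ★ (J-iso)^T's shape), `φ_w⁻¹(k_w τ(0,φ_w,θ_w) τ(x_w∕2,0,0) n_w τ(x_w∕2,0,0) k_w⁻¹)` at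
`w ∈ S′` (★ (A5a)'s split word) and `h_w` at `w ∈ ι`.  Measure identities only: ★ `orbFamG_apply`, ★ (A5a) §0, ★ (M1-a), ★ (A2)+(A3) inside the `g`-integral, ★ (A5b) swap.
[cite: Rogawski1990, §4.9 (4.9.1)–(4.9.2) p. 55; §8.2 p. 122; §8.3 p. 124] [cite: Folland1995, §2.2; §2.6 Thm. 2.49, (2.52)] [cite: Shelstad1979, §4 pp. 22–24]
[cite: Gelbart1975, §10 p. 155 (10.19)] [cite: DeitmarEchterhoff2014, Thm. 1.5.3; Lemma 9.3.3] [cite: BorelJacquet1979, §4.1] -/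
theorem orbFamG_eq_unfoldedModel_pi_isolate_of_regG (hα : ∀ i, α i ≠ 0) (hS' : ∀ w, w ∈ S' → w ∈ splitChartPlaces L α) (hp : ∀ w, p w → w ∉ S')
    {a' : ↥(arch (↥(maximalRealSubfield L)) L (IsCMField.complexConj L) 3 (Matrix.diagonal α)) → ℂ} (ha'c : Continuous a') (ha's : HasCompactSupport a')
    {c : {w : InfinitePlace L // IsComplex w} → Fin 3 → ℝ} (hc : c ∈ RegG S') :
    orbFamG L α ν' a' S' c =
      (∏ w ∈ Finset.univ.filter (fun w => w ∉ S'),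
          ((1 - (Circle.exp (c w 1 - c w 0) : ℂ)) * (1 - (Circle.exp (c w 2 - c w 0) : ℂ)) * (1 - (Circle.exp (c w 2 - c w 1) : ℂ)))) *
        (∏ w' : {w : {w : InfinitePlace L // IsComplex w} // ¬ p w}, ((t w'.1 (chartBoxImgGLoc L α w'.1 S')).toReal : ℂ)) *
        ((∏ w : {w : {w : InfinitePlace L // IsComplex w} // w ∈ S'}, (C w : ℝ) : ℝ) : ℂ) *
        ∫ g : (∀ w : {w : {w : InfinitePlace L // IsComplex w} // p w}, ↥(archLocal L 3 (Matrix.diagonal α) w.1)),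
          (∫ q : ((∀ i : {w : {w : InfinitePlace L // IsComplex w} // w ∉ S' ∧ ¬ p w}, ↥(archLocal L 3 (Matrix.diagonal α) i.1)) ⧸
                Subgroup.pi Set.univ (fun i : {w : {w : InfinitePlace L // IsComplex w} // w ∉ S' ∧ ¬ p w} => chartTorusGLoc L α i.1 S')) ×
              ({w : {w : InfinitePlace L // IsComplex w} // w ∈ S'} → ↥K × ↥(unipotentU (starRingEnd ℂ) J)),
            descConj (fun i : {w : {w : InfinitePlace L // IsComplex w} // w ∉ S' ∧ ¬ p w} => gprimeBlock L α i.1 S' c)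
              (Subgroup.pi Set.univ (fun i : {w : {w : InfinitePlace L // IsComplex w} // w ∉ S' ∧ ¬ p w} => chartTorusGLoc L α i.1 S'))
              (forall_mem_pi_chartTorusGLoc_comm L α S' (fun i : {w : {w : InfinitePlace L // IsComplex w} // w ∉ S' ∧ ¬ p w} => i.1) c)
              (fun g' => a' ((archPiEquivCM 3 L (Matrix.diagonal α)).symm
                ((MeasurableEquiv.piEquivPiSubtypeProd (fun w : {w : InfinitePlace L // IsComplex w} => ↥(archLocal L 3 (Matrix.diagonal α) w)) p).symm
                  (fun w => g w * gprimeBlockAt L α w.1 S' (c w.1) * (g w)⁻¹,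
                    fun w' : {w : {w : InfinitePlace L // IsComplex w} // ¬ p w} =>
                      if h : w'.1 ∈ S' then
                        (φ ⟨w'.1, h⟩).symm (((q.2 ⟨w'.1, h⟩).1 : ↥(unitaryGroupOfForm (starRingEnd ℂ) J)) *
                          (τ ![0, c w'.1 1, c w'.1 2] * τ ![c w'.1 0 / 2, 0, 0] * ((q.2 ⟨w'.1, h⟩).2 : ↥(unitaryGroupOfForm (starRingEnd ℂ) J)) * τ ![c w'.1 0 / 2, 0, 0]) *
                          ((q.2 ⟨w'.1, h⟩).1 : ↥(unitaryGroupOfForm (starRingEnd ℂ) J))⁻¹)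
                      else (g' ⟨w'.1, ⟨h, w'.2⟩⟩ : ↥(archLocal L 3 (Matrix.diagonal α) w'.1))))))
              q.1
            ∂((quotientMeasure (Subgroup.pi Set.univ (fun i : {w : {w : InfinitePlace L // IsComplex w} // w ∉ S' ∧ ¬ p w} => chartTorusGLoc L α i.1 S')) ρι
                  (isClosed_coe_pi _ fun i => isClosed_chartTorusGLoc L α i.1 S')
                  (Measure.pi fun i : {w : {w : InfinitePlace L // IsComplex w} // w ∉ S' ∧ ¬ p w} => ν'w i.1)).prod
              (Measure.pi fun _ : {w : {w : InfinitePlace L // IsComplex w} // w ∈ S'} => κ.prod μN)))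
          ∂(Measure.pi fun w : {w : {w : InfinitePlace L // IsComplex w} // p w} => ν'w w.1) := by
  -- ### instances (as ★ (A1) §3 ∕ ★ (A5a)): the local quotient measures, the split fibre `K × N`, the ι-quotient spectator
  haveI : ∀ w : {w : InfinitePlace L // IsComplex w}, IsClosed (chartTorusGLoc L α w S' : Set ↥(archLocal L 3 (Matrix.diagonal α) w)) :=
    fun w => isClosed_chartTorusGLoc L α w S'
  haveI : ∀ w : {w : InfinitePlace L // IsComplex w}, SecondCountableTopology (↥(archLocal L 3 (Matrix.diagonal α) w) ⧸ chartTorusGLoc L α w S') := fun w => inferInstance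
  haveI : ∀ w : {w : {w : InfinitePlace L // IsComplex w} // w ∈ S'},
      SigmaFinite (quotientMeasure (chartTorusGLoc L α w.1 S') (t w.1) (isClosed_chartTorusGLoc L α w.1 S') (ν'w w.1)) := fun w => inferInstance
  haveI : ∀ w, LocallyCompactSpace ↥(chartTorusGLoc L α w S') := fun w => locallyCompactSpace_chartTorusGLoc L α w S'
  haveI : ∀ w, SecondCountableTopology ↥(chartTorusGLoc L α w S') := fun w => TopologicalSpace.Subtype.secondCountableTopology _
  haveI : ∀ w, SigmaFinite (t w) := fun w => inferInstance
  have hMι : IsClosed ((Subgroup.pi Set.univ (fun i : {w : {w : InfinitePlace L // IsComplex w} // w ∉ S' ∧ ¬ p w} => chartTorusGLoc L α i.1 S')) :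
      Set (∀ i : {w : {w : InfinitePlace L // IsComplex w} // w ∉ S' ∧ ¬ p w}, ↥(archLocal L 3 (Matrix.diagonal α) i.1))) :=
    isClosed_coe_pi _ fun i => isClosed_chartTorusGLoc L α i.1 S'
  haveI : LocallyCompactSpace ↥(Subgroup.pi Set.univ (fun i : {w : {w : InfinitePlace L // IsComplex w} // w ∉ S' ∧ ¬ p w} => chartTorusGLoc L α i.1 S')) :=
    hMι.isClosedEmbedding_subtypeVal.locallyCompactSpace
  haveI : SecondCountableTopology ↥(Subgroup.pi Set.univ (fun i : {w : {w : InfinitePlace L // IsComplex w} // w ∉ S' ∧ ¬ p w} => chartTorusGLoc L α i.1 S')) :=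
    TopologicalSpace.Subtype.secondCountableTopology _
  haveI : SFinite ρι := inferInstance
  haveI : LocallyCompactSpace ↥(unitaryGroupOfForm (starRingEnd ℂ) J) := locallyCompactSpace_unitaryGroupOfForm_complex J
  haveI : SecondCountableTopology ↥(unitaryGroupOfForm (starRingEnd ℂ) J) := secondCountableTopology_unitaryGroupOfForm_complex J
  have hN : IsClosed (unipotentU (starRingEnd ℂ) J : Set ↥(unitaryGroupOfForm (starRingEnd ℂ) J)) := LineRing.isClosed_unipotentU _ _
  haveI : LocallyCompactSpace ↥(unipotentU (starRingEnd ℂ) J) := hN.isClosedEmbedding_subtypeVal.locallyCompactSpace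
  -- ### torus data on `U(J₃)(ℂ)` (★ (A5a) verbatim): `φ_w γ_w(c) = τ(c_w) = τ(0,θ,φ) τ(x∕2,0,0) τ(x∕2,0,0)`, diagonal units from `hτd`
  choose d hd hdc using hτd
  have hγt : ∀ w : {w : {w : InfinitePlace L // IsComplex w} // w ∈ S'}, (φ w) (gprimeBlockAt L α w.1 S' (c w.1)) = τ (c w.1) := fun w => by
    apply Subtype.ext
    apply Units.ext
    rw [← hφd w (c w.1), coe_glDiagonal, hτcoe]
    rfl
  have htms : ∀ w : {w : {w : InfinitePlace L // IsComplex w} // w ∈ S'},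
      τ (c w.1) = τ ![0, c w.1 1, c w.1 2] * τ ![c w.1 0 / 2, 0, 0] * τ ![c w.1 0 / 2, 0, 0] := fun w => by
    conv_lhs => rw [splitCoord_eq_add_half_add_half (c w.1)]
    rw [hτmul, hτmul]
  -- ### Steps 0–3: `orbFamG = cpt · split · chartOrbG` and ★ (M1-a) (the `p`-places isolated, split quotients × ONE ι-quotient inside)
  rw [orbFamG_apply L α ν' a' hS' c, archRG_eq_prod_cpt_mul_prod_split S' c,
    chartOrbG_eq_prod_mul_integral_pi_group_isolate_splitQuotient L α S' ν'w ν' hν t p ρι hρι hα hS' hp hc ha'c ha's]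
  -- ### Step 4: the (A3) integrand for a FIXED family of `p`-slots `g` is continuous on `(Π_{S′} U_w) × Ω_ι`
  have hFc : ∀ g : (∀ w : {w : {w : InfinitePlace L // IsComplex w} // p w}, ↥(archLocal L 3 (Matrix.diagonal α) w.1)), Continuous fun q :
      (∀ s : {w : {w : InfinitePlace L // IsComplex w} // w ∈ S'}, ↥(archLocal L 3 (Matrix.diagonal α) s.1)) ×
        ((∀ i : {w : {w : InfinitePlace L // IsComplex w} // w ∉ S' ∧ ¬ p w}, ↥(archLocal L 3 (Matrix.diagonal α) i.1)) ⧸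
          Subgroup.pi Set.univ (fun i : {w : {w : InfinitePlace L // IsComplex w} // w ∉ S' ∧ ¬ p w} => chartTorusGLoc L α i.1 S')) =>
      a' ((archPiEquivCM 3 L (Matrix.diagonal α)).symm
        ((MeasurableEquiv.piEquivPiSubtypeProd (fun w : {w : InfinitePlace L // IsComplex w} => ↥(archLocal L 3 (Matrix.diagonal α) w)) p).symm
          (fun w => g w * gprimeBlockAt L α w.1 S' (c w.1) * (g w)⁻¹,
            fun w' : {w : {w : InfinitePlace L // IsComplex w} // ¬ p w} =>
              if h : w'.1 ∈ S' then q.1 ⟨w'.1, h⟩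
              else
                descConj (fun i : {w : {w : InfinitePlace L // IsComplex w} // w ∉ S' ∧ ¬ p w} => gprimeBlock L α i.1 S' c)
                  (Subgroup.pi Set.univ (fun i : {w : {w : InfinitePlace L // IsComplex w} // w ∉ S' ∧ ¬ p w} => chartTorusGLoc L α i.1 S'))
                  (forall_mem_pi_chartTorusGLoc_comm L α S' (fun i : {w : {w : InfinitePlace L // IsComplex w} // w ∉ S' ∧ ¬ p w} => i.1) c)
                  (fun g' => (g' ⟨w'.1, ⟨h, w'.2⟩⟩ : ↥(archLocal L 3 (Matrix.diagonal α) w'.1))) q.2))) := fun g => by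
    refine ha'c.comp ((archPiEquivCM 3 L (Matrix.diagonal α)).symm.continuous.comp ?_)
    have hsymm : Continuous (MeasurableEquiv.piEquivPiSubtypeProd
        (fun w : {w : InfinitePlace L // IsComplex w} => ↥(archLocal L 3 (Matrix.diagonal α) w)) p).symm :=
      (Homeomorph.piEquivPiSubtypeProd p (fun w : {w : InfinitePlace L // IsComplex w} => ↥(archLocal L 3 (Matrix.diagonal α) w))).symm.continuous
    refine hsymm.comp (continuous_const.prodMk (continuous_pi fun w' => ?_))
    by_cases h : w'.1 ∈ S'
    · simp only [dif_pos h]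
      exact (continuous_apply _).comp continuous_fst
    · simp only [dif_neg h]
      exact (continuous_descConj _ _ _ (continuous_apply _)).comp continuous_snd
  -- ### Steps 4–5 pointwise in `g`: ★ (A2)+(A3) with spectator `Ω_ι` absorbs `Π_{S′} Δ_w`, then ★ (A5b) folds the ι-class first
  have hpt := fun g : (∀ w : {w : {w : InfinitePlace L // IsComplex w} // p w}, ↥(archLocal L 3 (Matrix.diagonal α) w.1)) => by
    have hB := prod_normaliser_smul_integral_pi_descConj_eq_smul_integral_pi_prod_symm hJ
      (fun w : {w : {w : InfinitePlace L // IsComplex w} // w ∈ S'} => chartTorusGLoc L α w.1 S')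
      (fun w => quotientMeasure (chartTorusGLoc L α w.1 S') (t w.1) (isClosed_chartTorusGLoc L α w.1 S') (ν'w w.1)) φ hφT
      (fun _ => K) (fun _ => κ) (fun _ => μN) hμC (fun w => forall_mem_chartTorusGLoc_comm L α w.1 S' (c w.1)) hγt
      (fun w => hτT _) (fun w => hτT _) htms (fun w => c w.1) (fun w => hc.2 w.1 w.2)
      (fun w => hd _) (fun w j => hdc _ j) (fun w => hd _) (fun w j => hdc _ j)
      (quotientMeasure (Subgroup.pi Set.univ (fun i : {w : {w : InfinitePlace L // IsComplex w} // w ∉ S' ∧ ¬ p w} => chartTorusGLoc L α i.1 S')) ρι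
        (isClosed_coe_pi _ fun i => isClosed_chartTorusGLoc L α i.1 S')
        (Measure.pi fun i : {w : {w : InfinitePlace L // IsComplex w} // w ∉ S' ∧ ¬ p w} => ν'w i.1)) _ (hFc g)
    have hswap := integral_prod_eq_integral_swap_descConj
      (fun i : {w : {w : InfinitePlace L // IsComplex w} // w ∉ S' ∧ ¬ p w} => gprimeBlock L α i.1 S' c)
      (Subgroup.pi Set.univ (fun i : {w : {w : InfinitePlace L // IsComplex w} // w ∉ S' ∧ ¬ p w} => chartTorusGLoc L α i.1 S'))
      (forall_mem_pi_chartTorusGLoc_comm L α S' (fun i : {w : {w : InfinitePlace L // IsComplex w} // w ∉ S' ∧ ¬ p w} => i.1) c)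
      (Measure.pi fun _ : {w : {w : InfinitePlace L // IsComplex w} // w ∈ S'} => κ.prod μN)
      (quotientMeasure (Subgroup.pi Set.univ (fun i : {w : {w : InfinitePlace L // IsComplex w} // w ∉ S' ∧ ¬ p w} => chartTorusGLoc L α i.1 S')) ρι
        (isClosed_coe_pi _ fun i => isClosed_chartTorusGLoc L α i.1 S')
        (Measure.pi fun i : {w : {w : InfinitePlace L // IsComplex w} // w ∉ S' ∧ ¬ p w} => ν'w i.1))
      a'
      (fun gu : (∀ i : {w : {w : InfinitePlace L // IsComplex w} // w ∉ S' ∧ ¬ p w}, ↥(archLocal L 3 (Matrix.diagonal α) i.1)) ×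
          ({w : {w : InfinitePlace L // IsComplex w} // w ∈ S'} → ↥K × ↥(unipotentU (starRingEnd ℂ) J)) =>
        (archPiEquivCM 3 L (Matrix.diagonal α)).symm
          ((MeasurableEquiv.piEquivPiSubtypeProd (fun w : {w : InfinitePlace L // IsComplex w} => ↥(archLocal L 3 (Matrix.diagonal α) w)) p).symm
            (fun w => g w * gprimeBlockAt L α w.1 S' (c w.1) * (g w)⁻¹,
              fun w' : {w : {w : InfinitePlace L // IsComplex w} // ¬ p w} =>
                if h : w'.1 ∈ S' then
                  (φ ⟨w'.1, h⟩).symm (((gu.2 ⟨w'.1, h⟩).1 : ↥(unitaryGroupOfForm (starRingEnd ℂ) J)) *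
                    (τ ![0, c w'.1 1, c w'.1 2] * τ ![c w'.1 0 / 2, 0, 0] * ((gu.2 ⟨w'.1, h⟩).2 : ↥(unitaryGroupOfForm (starRingEnd ℂ) J)) * τ ![c w'.1 0 / 2, 0, 0]) *
                    ((gu.2 ⟨w'.1, h⟩).1 : ↥(unitaryGroupOfForm (starRingEnd ℂ) J))⁻¹)
                else (gu.1 ⟨w'.1, ⟨h, w'.2⟩⟩ : ↥(archLocal L 3 (Matrix.diagonal α) w'.1)))))
      (fun q : ({w : {w : InfinitePlace L // IsComplex w} // w ∈ S'} → ↥K × ↥(unipotentU (starRingEnd ℂ) J)) ×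
          ((∀ i : {w : {w : InfinitePlace L // IsComplex w} // w ∉ S' ∧ ¬ p w}, ↥(archLocal L 3 (Matrix.diagonal α) i.1)) ⧸
            Subgroup.pi Set.univ (fun i : {w : {w : InfinitePlace L // IsComplex w} // w ∉ S' ∧ ¬ p w} => chartTorusGLoc L α i.1 S')) =>
        a' ((archPiEquivCM 3 L (Matrix.diagonal α)).symm
          ((MeasurableEquiv.piEquivPiSubtypeProd (fun w : {w : InfinitePlace L // IsComplex w} => ↥(archLocal L 3 (Matrix.diagonal α) w)) p).symm
            (fun w => g w * gprimeBlockAt L α w.1 S' (c w.1) * (g w)⁻¹,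
              fun w' : {w : {w : InfinitePlace L // IsComplex w} // ¬ p w} =>
                if h : w'.1 ∈ S' then
                  (φ ⟨w'.1, h⟩).symm (((q.1 ⟨w'.1, h⟩).1 : ↥(unitaryGroupOfForm (starRingEnd ℂ) J)) *
                    (τ ![0, c w'.1 1, c w'.1 2] * τ ![c w'.1 0 / 2, 0, 0] * ((q.1 ⟨w'.1, h⟩).2 : ↥(unitaryGroupOfForm (starRingEnd ℂ) J)) * τ ![c w'.1 0 / 2, 0, 0]) *
                    ((q.1 ⟨w'.1, h⟩).1 : ↥(unitaryGroupOfForm (starRingEnd ℂ) J))⁻¹)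
                else
                  descConj (fun i : {w : {w : InfinitePlace L // IsComplex w} // w ∉ S' ∧ ¬ p w} => gprimeBlock L α i.1 S' c)
                    (Subgroup.pi Set.univ (fun i : {w : {w : InfinitePlace L // IsComplex w} // w ∉ S' ∧ ¬ p w} => chartTorusGLoc L α i.1 S'))
                    (forall_mem_pi_chartTorusGLoc_comm L α S' (fun i : {w : {w : InfinitePlace L // IsComplex w} // w ∉ S' ∧ ¬ p w} => i.1) c)
                    (fun g' => (g' ⟨w'.1, ⟨h, w'.2⟩⟩ : ↥(archLocal L 3 (Matrix.diagonal α) w'.1))) q.2))))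
      (fun u g' => rfl)
    have h := hB.trans (congrArg (fun y => (∏ w : {w : {w : InfinitePlace L // IsComplex w} // w ∈ S'}, (C w : ℝ)) • y) hswap)
    beta_reduce at h
    rw [Complex.real_smul, Complex.real_smul, Complex.ofReal_prod] at h
    exact h
  -- ### assembly: integrate the pointwise identity in `g`, pull the constants, `orbFamG = cpt · split · (Π_{¬p} t_w(B′_w)) · ∫ …`
  have hI := integral_congr_ae (μ := Measure.pi fun w : {w : {w : InfinitePlace L // IsComplex w} // p w} => ν'w w.1) (Filter.Eventually.of_forall hpt)
  rw [integral_const_mul, integral_const_mul] at hI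
  linear_combination ((∏ w ∈ Finset.univ.filter (fun w => w ∉ S'),
      ((1 - (Circle.exp (c w 1 - c w 0) : ℂ)) * (1 - (Circle.exp (c w 2 - c w 0) : ℂ)) * (1 - (Circle.exp (c w 2 - c w 1) : ℂ)))) *
    (∏ w' : {w : {w : InfinitePlace L // IsComplex w} // ¬ p w}, ((t w'.1 (chartBoxImgGLoc L α w'.1 S')).toReal : ℂ))) * hI

end IsolateFinset

end Literature.NumberTheory.Rogawski1990

end
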